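import Literature.AlgebraicGeometry.HodgeTheory.KunnethComponentsDiagonalTranspose
import HarnessLib

/-!
# The Künneth components of the diagonal are natural under isomorphisms; `C(X)` is an isomorphism invariant

Family `hodge`, layer `Literature/AlgebraicGeometry/HodgeTheory`; lane `lit-hodgefound`. THEOREMS ONLY
(no definition, no named fact; D-0026), on the tree's carriers `kunnethPiece`, `diagonalClass hX = Δ_* 1`
(complex orientations) and the Künneth families `π : Fin (2n+1) → H²ⁿ((X ⊗ X)(ℂ); ℂ)` of `cl(Δ_X)`
(`π i ∈ H^{2n−i}(X) ⊗ Hⁱ(X)`, `Σ π i = cl(Δ)`; unique, `kunnethComponents_diagonalClass_unique`).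

For an isomorphism `e : X ≅ X'` of smooth projective complex `n`-folds, `e × e` carries `Δ_X` onto
`Δ_{X'}`, so `(e × e)^* cl(Δ_{X'}) = cl(Δ_X)` and `(e × e)^*` matches the Künneth decompositions; in
particular the Künneth standard conjecture `C(X)` ("the Künneth components of the diagonal are
algebraic", Kleiman 1968 §1; Kahn 2020 Def. 6.29 b): "`p_X^i` is algebraic") depends only on the
isomorphism class of `X` — the form in which it is used for a variety given by different models
(e.g. the tree's Plücker Grassmannian, Fermat models). Sources: W. Fulton, *Intersection Theory*
(1998) §1.4 / Lemma 19.1.2 (`σ_* = (σ⁻¹)^*` for an isomorphism, degree `1`; the tree's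
`complexBetti_map_complexGysin_of_comp_eq_id`, `complexGysin_comp_one_of_isBirational`), Ex. 16.1.11;
A. Grothendieck, *La théorie des classes de Chern* / Topology 8 (1969) §1 (transport of supports along
isomorphisms; the tree's `IsoTransport`); B. Kahn, *Zeta and L-functions of varieties and motives*
(2020) §6.9 Def. 6.28–6.29, Lemma 6.30 (2) (Künneth projectors of isomorphic motives).

## What is proved

* §1 `map_tensorHom_cupProduct_fst_snd`, **`map_tensorHom_mem_kunnethPiece`** — `(f ⊗ g)^*` carries the
  Künneth piece `Hⁱ(X') ⊗ Hʲ(Y')` into `Hⁱ(X) ⊗ Hʲ(Y)` for ANY morphisms `f : X ⟶ X'`, `g : Y ⟶ Y'`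
  (`(f ⊗ g)^*(pr^* a ∪ pr^* b) = pr^*(f^* a) ∪ pr^*(g^* b)`).
* §2 `isBirational_left_of_isIso`, `diagonal_comp_tensorHom`, **`complexBetti_map_tensorIso_diagonalClass`**
  — `(e.hom ⊗ e.hom)^* cl(Δ_{X'}) = cl(Δ_X)` for an isomorphism `e : X ≅ X'` of smooth projective
  `n`-folds (complex orientations).
* §3 **`complexBetti_map_tensorIso_kunnethComponent_diagonalClass`** — `(e.hom ⊗ e.hom)^*(π' i) = π i`
  for Künneth families `π'` of `cl(Δ_{X'})` and `π` of `cl(Δ_X)`; `…_self` — the Künneth components of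
  `cl(Δ_X)` are invariant under `g × g` for every automorphism `g` of `X`.
* §4 **`kunnethComponent_diagonalClass_mem_algebraicClasses_iff_of_iso`**,
  `…_mem_supportedClasses_iff_of_iso` — `π i` is algebraic (of coniveau `≥ c`) iff `π' i` is;
  **`kunnethComponents_algebraic_iff_of_iso`** — `C(X) ⟺ C(X')`.

## References

* [Fulton1998] W. Fulton, Intersection Theory, 2nd ed., Springer 1998, §1.4, Lemma 19.1.2, §16.1
  Ex. 16.1.11.
* [Kleiman1968AlgebraicCycles] S. Kleiman, Algebraic cycles and the Weil conjectures (1968), §1.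
* [Kahn2020] B. Kahn, Zeta and L-functions of varieties and motives, CUP 2020, §6.9 Def. 6.28–6.29,
  Lemma 6.30 (2).
* [GrothendieckTopology1969] A. Grothendieck, Hodge's general conjecture is false for trivial reasons,
  Topology 8 (1969), §1.
* [HatcherAT2002] A. Hatcher, Algebraic Topology, CUP 2002, §3.2 Prop. 3.10.
-/

noncomputable section

open CategoryTheory AlgebraicGeometry MonoidalCategory CartesianMonoidalCategory Finset
open Literature.AlgebraicTopology.SingularHomology
open Literature.AlgebraicGeometry.Motives (IsSmoothProjective ComplexPoints)

namespace Literature.AlgebraicGeometry.HodgeTheory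

variable {m n : ℕ} {X Y X' Y' : Motives.SchemeOver ℂ}

/-! ### §1 `(f ⊗ g)^*` respects the Künneth pieces -/

/-- `(f ⊗ g)^* pr_{X'}^* a = pr_X^* (f^* a)` (`(f ⊗ g) ≫ fst = fst ≫ f`; Summits-side twin, not importable
from `Literature/`: `Summit.HodgeConjecture.….WeilTwelvefoldsSqrtMinus7.AmnesicSecantSheaves.map_tensorHom_map_fst`).
[cite: HatcherAT2002, §3.2 Prop. 3.10] -/
theorem complexBetti_map_tensorHom_map_fst (f : X ⟶ X') (g : Y ⟶ Y') (i : ℕ) (a : complexBetti X' i) :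
    complexBetti.map (f ⊗ₘ g) i (complexBetti.map (fst X' Y') i a) =
      complexBetti.map (fst X Y) i (complexBetti.map f i a) := by
  rw [← ModuleCat.comp_apply, ← complexBetti.map_comp, tensorHom_fst, complexBetti.map_comp,
    ModuleCat.comp_apply]

/-- `(f ⊗ g)^* pr_{Y'}^* b = pr_Y^* (g^* b)` (`(f ⊗ g) ≫ snd = snd ≫ g`; Summits-side twin:
`Summit.HodgeConjecture.….WeilTwelvefoldsSqrtMinus7.AmnesicSecantSheaves.map_tensorHom_map_snd`).
[cite: HatcherAT2002, §3.2 Prop. 3.10] -/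
theorem complexBetti_map_tensorHom_map_snd (f : X ⟶ X') (g : Y ⟶ Y') (j : ℕ) (b : complexBetti Y' j) :
    complexBetti.map (f ⊗ₘ g) j (complexBetti.map (snd X' Y') j b) =
      complexBetti.map (snd X Y) j (complexBetti.map g j b) := by
  rw [← ModuleCat.comp_apply, ← complexBetti.map_comp, tensorHom_snd, complexBetti.map_comp,
    ModuleCat.comp_apply]

/-- **`(f ⊗ g)^*(pr^* a ∪ pr^* b) = pr^*(f^* a) ∪ pr^*(g^* b)`**: pull-back along a product morphism
of a cross product is the cross product of the pull-backs. [cite: HatcherAT2002, §3.2 Prop. 3.10] -/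
theorem map_tensorHom_cupProduct_fst_snd (f : X ⟶ X') (g : Y ⟶ Y') {i j k : ℕ} (h : i + j = k)
    (a : complexBetti X' i) (b : complexBetti Y' j) :
    complexBetti.map (f ⊗ₘ g) k
        (cupProduct h (complexBetti.map (fst X' Y') i a) (complexBetti.map (snd X' Y') j b)) =
      cupProduct h (complexBetti.map (fst X Y) i (complexBetti.map f i a))
        (complexBetti.map (snd X Y) j (complexBetti.map g j b)) := by
  rw [complexBetti.map, cupProduct_map, ← complexBetti.map, ← complexBetti.map,
    complexBetti_map_tensorHom_map_fst, complexBetti_map_tensorHom_map_snd]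

/-- **`(f ⊗ g)^*(Hⁱ(X') ⊗ Hʲ(Y')) ⊆ Hⁱ(X) ⊗ Hʲ(Y)`**: pull-back along a product morphism respects the
Künneth pieces (Künneth projectors are natural — Kahn Lemma 6.30: `p^i_M` is central, it commutes with
every morphism of motives). [cite: Kahn2020, §6.9 proof of Lemma 6.30] [cite: HatcherAT2002, §3.2 Prop. 3.10] -/
theorem map_tensorHom_mem_kunnethPiece (f : X ⟶ X') (g : Y ⟶ Y') {i j k : ℕ} {h : i + j = k}
    {z : complexBetti (X' ⊗ Y') k} (hz : z ∈ kunnethPiece X' Y' h) :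
    complexBetti.map (f ⊗ₘ g) k z ∈ kunnethPiece X Y h := by
  induction hz using Submodule.span_induction with
  | mem w hw =>
    obtain ⟨a, b, rfl⟩ := hw
    rw [map_tensorHom_cupProduct_fst_snd]
    exact cupProduct_fst_snd_mem_kunnethPiece h _ _
  | zero => rw [map_zero]; exact Submodule.zero_mem _
  | add w w' _ _ hw hw' => rw [map_add]; exact Submodule.add_mem _ hw hw'
  | smul c w _ hw => rw [map_smul]; exact Submodule.smul_mem _ c hw

/-! ### §2 `(e × e)^* cl(Δ_{X'}) = cl(Δ_X)` for an isomorphism `e : X ≅ X'` -/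

/-- The scheme morphism underlying an isomorphism over `ℂ` is birational (it is an isomorphism of
schemes: `U = ⊤` in Stacks Tag 01RN). [cite: Fulton1998, §1.4] -/
theorem isBirational_left_of_isIso (f : X ⟶ X') [IsIso f] : Resolution.IsBirational f.left := by
  haveI : IsIso f.left :=
    ⟨(inv f).left, by rw [← Over.comp_left, IsIso.hom_inv_id]; rfl,
      by rw [← Over.comp_left, IsIso.inv_hom_id]; rfl⟩
  refine ⟨⊤, dense_univ, ?_, ?_⟩
  · rw [Scheme.Hom.preimage_top]
    exact dense_univ
  · exact IsZariskiLocalAtTarget.restrict (P := MorphismProperty.isomorphisms Scheme)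
      (show IsIso f.left from inferInstance) ⊤

/-- `Δ_{X'} ≫ (g ⊗ g) = g ≫ Δ_X` for `g : X' ⟶ X`: the diagonal is natural. [cite: Fulton1998, §16.1 Ex. 16.1.11] -/
@[reassoc]
theorem diagonal_comp_tensorHom (g : X' ⟶ X) :
    lift (𝟙 X') (𝟙 X') ≫ (g ⊗ₘ g) = g ≫ lift (𝟙 X) (𝟙 X) := by
  ext <;> simp

/-- **`(e × e)^* cl(Δ_{X'}) = cl(Δ_X)`** for an isomorphism `e : X ≅ X'` of smooth projective complex
`n`-folds (complex orientations): `(e × e)^*(Δ_{X'*} 1) = (Δ_{X'} ≫ (e⁻¹ × e⁻¹))_* 1 = (e⁻¹ ≫ Δ_X)_* 1 =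
Δ_{X*}(e⁻¹_* 1) = Δ_{X*} 1` — pull-back along the isomorphism `e × e` is push-forward along its inverse,
and `e⁻¹_* 1 = 1` (degree `+1`, Fulton Lemma 19.1.2). [cite: Fulton1998, Lemma 19.1.2 and §16.1 Ex. 16.1.11] -/
theorem complexBetti_map_tensorIso_diagonalClass (hX : IsSmoothProjective n X)
    (hX' : IsSmoothProjective n X') (e : X ≅ X') :
    complexBetti.map (e.hom ⊗ₘ e.hom) (2 * n) (diagonalClass hX') = diagonalClass hX := by
  have hXX := Motives.IsSmoothProjective.tensor_holds hX hX
  have hXX' := Motives.IsSmoothProjective.tensor_holds hX' hX'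
  have hinv : (e.inv ⊗ₘ e.inv) ≫ (e.hom ⊗ₘ e.hom) = 𝟙 _ := (e ⊗ᵢ e).inv_hom_id
  haveI : IsIso (e.inv ⊗ₘ e.inv) := inferInstanceAs (IsIso (e ⊗ᵢ e).inv)
  rw [diagonalClass, diagonalClass,
    complexBetti_map_complexGysin_of_comp_eq_id hXX hXX' (e.hom ⊗ₘ e.hom) (e.inv ⊗ₘ e.inv) hinv
      (isBirational_left_of_isIso _) hX' (lift (𝟙 X') (𝟙 X')) _ (singularCohomology.one ℂ (ComplexPoints X')),
    diagonal_comp_tensorHom]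
  exact complexGysin_comp_one_of_isBirational hX' hX hXX e.inv (isBirational_left_of_isIso _)
    (lift (𝟙 X) (𝟙 X)) _

/-! ### §3 `(e × e)^*` matches the Künneth decompositions of `cl(Δ_{X'})` and `cl(Δ_X)` -/

/-- **The Künneth components of the diagonal are natural under isomorphisms**: for `e : X ≅ X'`
(smooth projective `n`-folds) and Künneth families `π` of `cl(Δ_X)`, `π'` of `cl(Δ_{X'})`,
`(e × e)^*(π' i) = π i` for every `i` — `(e × e)^* ∘ π'` is again a Künneth family (§1) with sum
`(e × e)^* cl(Δ_{X'}) = cl(Δ_X)` (§2), hence equals `π` (uniqueness). (Kahn: the Künneth projectors of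
isomorphic motives correspond.) [cite: Kahn2020, §6.9 Def. 6.28 and proof of Lemma 6.30]
[cite: Kleiman1968AlgebraicCycles, §1] -/
theorem complexBetti_map_tensorIso_kunnethComponent_diagonalClass (hX : IsSmoothProjective n X)
    (hX' : IsSmoothProjective n X') (e : X ≅ X')
    {π : Fin (2 * n + 1) → complexBetti (X ⊗ X) (2 * n)}
    (hπ : ∀ i : Fin (2 * n + 1), π i ∈ kunnethPiece X X (show (2 * n - (i : ℕ)) + i = 2 * n by omega))
    (hΔ : ∑ i, π i = diagonalClass hX)
    {π' : Fin (2 * n + 1) → complexBetti (X' ⊗ X') (2 * n)}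
    (hπ' : ∀ i : Fin (2 * n + 1), π' i ∈ kunnethPiece X' X' (show (2 * n - (i : ℕ)) + i = 2 * n by omega))
    (hΔ' : ∑ i, π' i = diagonalClass hX') (i : Fin (2 * n + 1)) :
    complexBetti.map (e.hom ⊗ₘ e.hom) (2 * n) (π' i) = π i := by
  have h := kunnethComponents_diagonalClass_unique hX
    (π := fun i ↦ complexBetti.map (e.hom ⊗ₘ e.hom) (2 * n) (π' i))
    (fun i ↦ map_tensorHom_mem_kunnethPiece e.hom e.hom (hπ' i))
    (by rw [← map_sum, hΔ', complexBetti_map_tensorIso_diagonalClass hX hX' e]) hπ hΔ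
  exact congrFun h i

/-- **The Künneth components of `cl(Δ_X)` are invariant under `g × g` for every automorphism `g` of `X`.**
[cite: Kleiman1968AlgebraicCycles, §1] [cite: Kahn2020, §6.9 proof of Lemma 6.30] -/
theorem complexBetti_map_tensorIso_kunnethComponent_diagonalClass_self (hX : IsSmoothProjective n X)
    (g : X ≅ X) {π : Fin (2 * n + 1) → complexBetti (X ⊗ X) (2 * n)}
    (hπ : ∀ i : Fin (2 * n + 1), π i ∈ kunnethPiece X X (show (2 * n - (i : ℕ)) + i = 2 * n by omega))
    (hΔ : ∑ i, π i = diagonalClass hX) (i : Fin (2 * n + 1)) :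
    complexBetti.map (g.hom ⊗ₘ g.hom) (2 * n) (π i) = π i :=
  complexBetti_map_tensorIso_kunnethComponent_diagonalClass hX hX g hπ hΔ hπ hΔ i

/-! ### §4 `C(X)` is an isomorphism invariant -/

/-- **`π i` is algebraic iff `π' i` is** (`e : X ≅ X'`; Künneth families `π` of `cl(Δ_X)`, `π'` of
`cl(Δ_{X'})`): `π i = (e × e)^* π' i` and pull-back along the isomorphism `e × e` preserves and reflects
algebraic classes (`mem_algebraicClasses_map_iff_of_iso`). [cite: GrothendieckTopology1969, §1]
[cite: Kahn2020, §6.9 Lemma 6.30 (2)] -/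
theorem kunnethComponent_diagonalClass_mem_algebraicClasses_iff_of_iso (hX : IsSmoothProjective n X)
    (hX' : IsSmoothProjective n X') (e : X ≅ X')
    {π : Fin (2 * n + 1) → complexBetti (X ⊗ X) (2 * n)}
    (hπ : ∀ i : Fin (2 * n + 1), π i ∈ kunnethPiece X X (show (2 * n - (i : ℕ)) + i = 2 * n by omega))
    (hΔ : ∑ i, π i = diagonalClass hX)
    {π' : Fin (2 * n + 1) → complexBetti (X' ⊗ X') (2 * n)}
    (hπ' : ∀ i : Fin (2 * n + 1), π' i ∈ kunnethPiece X' X' (show (2 * n - (i : ℕ)) + i = 2 * n by omega))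
    (hΔ' : ∑ i, π' i = diagonalClass hX') (i : Fin (2 * n + 1)) :
    π i ∈ algebraicClasses (X ⊗ X) n ↔ π' i ∈ algebraicClasses (X' ⊗ X') n := by
  rw [← complexBetti_map_tensorIso_kunnethComponent_diagonalClass hX hX' e hπ hΔ hπ' hΔ' i]
  exact mem_algebraicClasses_map_iff_of_iso (e ⊗ᵢ e)

/-- **`π i ∈ Nᶜ H²ⁿ((X ⊗ X)(ℂ))` iff `π' i ∈ Nᶜ H²ⁿ((X' ⊗ X')(ℂ))`** (`mem_supportedClasses_map_iff_of_iso`).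
[cite: GrothendieckTopology1969, §1] -/
theorem kunnethComponent_diagonalClass_mem_supportedClasses_iff_of_iso (hX : IsSmoothProjective n X)
    (hX' : IsSmoothProjective n X') (e : X ≅ X')
    {π : Fin (2 * n + 1) → complexBetti (X ⊗ X) (2 * n)}
    (hπ : ∀ i : Fin (2 * n + 1), π i ∈ kunnethPiece X X (show (2 * n - (i : ℕ)) + i = 2 * n by omega))
    (hΔ : ∑ i, π i = diagonalClass hX)
    {π' : Fin (2 * n + 1) → complexBetti (X' ⊗ X') (2 * n)}
    (hπ' : ∀ i : Fin (2 * n + 1), π' i ∈ kunnethPiece X' X' (show (2 * n - (i : ℕ)) + i = 2 * n by omega))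
    (hΔ' : ∑ i, π' i = diagonalClass hX') (i : Fin (2 * n + 1)) (c : ℕ) :
    π i ∈ supportedClasses (X ⊗ X) (2 * n) c ↔ π' i ∈ supportedClasses (X' ⊗ X') (2 * n) c := by
  rw [← complexBetti_map_tensorIso_kunnethComponent_diagonalClass hX hX' e hπ hΔ hπ' hΔ' i]
  exact mem_supportedClasses_map_iff_of_iso (e ⊗ᵢ e)

/-- **`C(X) ⟺ C(X')` for isomorphic smooth projective complex varieties**: all Künneth components of
`cl(Δ_X)` (in one, equivalently every, Künneth decomposition) are algebraic iff the same holds for `X'`.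
[cite: Kahn2020, §6.9 Def. 6.29 and Lemma 6.30 (2)] [cite: Kleiman1968AlgebraicCycles, §1] -/
theorem kunnethComponents_algebraic_iff_of_iso (hX : IsSmoothProjective n X)
    (hX' : IsSmoothProjective n X') (e : X ≅ X')
    {π : Fin (2 * n + 1) → complexBetti (X ⊗ X) (2 * n)}
    (hπ : ∀ i : Fin (2 * n + 1), π i ∈ kunnethPiece X X (show (2 * n - (i : ℕ)) + i = 2 * n by omega))
    (hΔ : ∑ i, π i = diagonalClass hX)
    {π' : Fin (2 * n + 1) → complexBetti (X' ⊗ X') (2 * n)}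
    (hπ' : ∀ i : Fin (2 * n + 1), π' i ∈ kunnethPiece X' X' (show (2 * n - (i : ℕ)) + i = 2 * n by omega))
    (hΔ' : ∑ i, π' i = diagonalClass hX') :
    (∀ i, π i ∈ algebraicClasses (X ⊗ X) n) ↔ ∀ i, π' i ∈ algebraicClasses (X' ⊗ X') n :=
  forall_congr' fun i ↦
    kunnethComponent_diagonalClass_mem_algebraicClasses_iff_of_iso hX hX' e hπ hΔ hπ' hΔ' i

end Literature.AlgebraicGeometry.HodgeTheory

end
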